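import Mathlib

/-!
# Route OverlapGapAlgebra, crux `SearchHardWindow` (stmt-PneNP-2460), line `Sketch`: the
# exponent asymptotics of the chaos lemma (Huang–Sellke 2025, Lemma 3.23)

Stub `stub_chaosAsymptotics` of the skeleton
`Summits/PneNP/PneNP/Cruxes/SearchHardWindow/Lines/Sketch.lean` (section `CHAOS`): the pure
real-analysis half of the chaos lemma for random `k`-SAT. The first moment bounds the mass of the
chaos event by `(k+1) (K+1)^{k+1} (n+1)^{2^k} e^{nβ} (1 - (E/2)^k)^m` with `m = ⌊α n⌋`,
`α = 5 · 2^k log k / k`, chain length `K ≤ n^A` and resampling rate `E ≥ 1 - e^{-1/(bk)}`.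

Write `L := 5 log k / k > 0` (as `k ≥ 2`), `r := max (β / L) 0 ∈ [0, 1)` (as `β < L`),
`δ := (1 - r) / (2k) ∈ (0, 1)` and `b₁ := 1 / (k · (-log δ)) > 0`. For `0 < b ≤ b₁` one has
`e^{-1/(bk)} ≤ δ`, so every admissible `E` satisfies `1 - δ ≤ E ≤ 1`, whence by Bernoulli
`E^k ≥ 1 + k (E - 1) ≥ 1 - k δ = (1 + r)/2`. Since `α (E/2)^k = L E^k ≥ L (1 + r)/2` and
`m ≥ α n - 1`, `(1 - (E/2)^k)^m ≤ exp (-(E/2)^k m) ≤ e · exp (-(L (1+r)/2) n)`, and the gap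
`g := L (1 + r)/2 - β ≥ L (1 - r)/2 > 0`. The remaining factor
`(k+1) (K+1)^{k+1} (n+1)^{2^k} e ≤ (k+1) 2^{k+1} e (n+1)^{A(k+1) + 2^k}` is a polynomial in `n`,
eventually `≤ exp ((g/2) n)` (`isLittleO_pow_exp_pos_mul_atTop`), giving the bound
`exp (-(g/2) n)`, i.e. `c := g / 2`.
-/

set_option linter.dupNamespace false -- `Summit.PneNP.PneNP.…`: summit = sub-problem

namespace Summit.PneNP.PneNP.Theorems

open Finset Filter Asymptotics Topology

/-- A polynomial in `n` is eventually dominated by any growing exponential: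
`C (n+1)^N ≤ exp (a n)` for all large `n : ℕ`, whenever `0 < a`. -/
theorem cha_poly_le_exp (C : ℝ) (N : ℕ) {a : ℝ} (ha : 0 < a) :
    ∀ᶠ n : ℕ in atTop, C * ((n : ℝ) + 1) ^ N ≤ Real.exp (a * n) := by
  have hlo := (isLittleO_pow_exp_pos_mul_atTop N ha).comp_tendsto
    (tendsto_atTop_add_const_right _ _ tendsto_natCast_atTop_atTop :
      Tendsto (fun n : ℕ => (n : ℝ) + 1) atTop atTop)
  have hD : 0 < (|C| + 1) * Real.exp a := by positivity
  filter_upwards [hlo.bound (inv_pos.2 hD)] with n hn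
  have h0 : (0 : ℝ) ≤ (n : ℝ) + 1 := by positivity
  simp only [Function.comp_def, Real.norm_eq_abs, abs_pow, abs_of_nonneg h0, abs_mul,
    Real.abs_exp, mul_add, mul_one, Real.exp_add] at hn
  calc C * ((n : ℝ) + 1) ^ N ≤ (|C| + 1) * ((n : ℝ) + 1) ^ N := by
        gcongr
        exact (le_abs_self C).trans (le_add_of_nonneg_right zero_le_one)
    _ ≤ (|C| + 1) * (((|C| + 1) * Real.exp a)⁻¹ * (Real.exp (a * n) * Real.exp a)) := by gcongr
    _ = Real.exp (a * n) * (((|C| + 1) * Real.exp a) * ((|C| + 1) * Real.exp a)⁻¹) := by ring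
    _ = Real.exp (a * n) := by rw [mul_inv_cancel₀ hD.ne', mul_one]

/-- **The exponent asymptotics of the chaos lemma** (Huang–Sellke 2025, arXiv:2501.06427,
Lemma 3.23; real analysis only): for `k ≥ 2` and `β < 5 log k / k` there is `b₁ > 0` such that
for every `0 < b ≤ b₁` and every polynomial degree `A` there is `c > 0` with, eventually in
`n`, for all `K ≤ n^A` and all resampling rates `E ∈ [1 − e^{−1/(bk)}, 1]`:
`(k+1)(K+1)^{k+1} (n+1)^{2^k} e^{nβ} (1 − (E/2)^k)^{⌊α_k n⌋} ≤ e^{−cn}`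
(`α_k (E/2)^k = 5 E^k log k / k > β` once `(1 − e^{−1/(b₁ k)})^k · 5 log k/k > β`). -/
theorem stub_chaosAsymptotics (k : ℕ) (hk : 2 ≤ k) (β : ℝ) (hβ : β < 5 * Real.log k / k) :
    ∃ b₁ : ℝ, 0 < b₁ ∧ ∀ b : ℝ, 0 < b → b ≤ b₁ → ∀ A : ℕ, ∃ c : ℝ, 0 < c ∧
      ∀ᶠ n : ℕ in atTop, ∀ K : ℕ, K ≤ n ^ A → ∀ E : ℝ, 1 - Real.exp (-(1 / (b * k))) ≤ E → E ≤ 1 →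
        ((k : ℝ) + 1) * ((K : ℝ) + 1) ^ (k + 1) *
            ((((n : ℝ) + 1) ^ (2 ^ k)) * Real.exp (n * β)) *
            (1 - (E / 2) ^ k) ^ ⌊5 * 2 ^ k * Real.log k / k * n⌋₊
          ≤ Real.exp (-(c * n)) := by
  -- the constants `L = 5 log k / k`, `r = max (β / L) 0`, `δ = (1 - r) / (2k)`
  have hk1 : (1 : ℝ) < k := by exact_mod_cast hk
  have hk2 : (2 : ℝ) ≤ k := by exact_mod_cast hk
  have hk0 : (0 : ℝ) < k := one_pos.trans hk1
  have hkne : (k : ℝ) ≠ 0 := hk0.ne'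
  have hlogk : 0 < Real.log k := Real.log_pos hk1
  obtain ⟨L, hL⟩ : ∃ L : ℝ, L = 5 * Real.log k / k := ⟨_, rfl⟩
  have hLpos : 0 < L := hL ▸ div_pos (mul_pos (by norm_num) hlogk) hk0
  have hLne : L ≠ 0 := hLpos.ne'
  rw [← hL] at hβ
  obtain ⟨r, hr⟩ : ∃ r : ℝ, r = max (β / L) 0 := ⟨_, rfl⟩
  have hr0 : 0 ≤ r := hr ▸ le_max_right _ _
  have hr1 : r < 1 := hr ▸ max_lt ((div_lt_one hLpos).2 hβ) one_pos
  have hβr : β ≤ r * L := by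
    rw [hr]
    calc β = β / L * L := by field_simp
      _ ≤ max (β / L) 0 * L := by gcongr; exact le_max_left _ _
  obtain ⟨δ, hδ⟩ : ∃ δ : ℝ, δ = (1 - r) / (2 * k) := ⟨_, rfl⟩
  have hδpos : 0 < δ := hδ ▸ div_pos (by linarith) (by positivity)
  have hδ1 : δ < 1 := by
    rw [hδ, div_lt_one (by positivity)]
    linarith
  have hkδ : (k : ℝ) * δ = (1 - r) / 2 := by
    rw [hδ]
    field_simp
  have hlogδ' : Real.log δ < 0 := Real.log_neg hδpos hδ1
  have hlogδne : Real.log δ ≠ 0 := hlogδ'.ne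
  have hlogδ : 0 < -Real.log δ := neg_pos.2 hlogδ'
  -- the choice of `b₁`
  refine ⟨1 / (k * -Real.log δ), by positivity, ?_⟩
  intro b hb hb₁ A
  -- the gap `g = L (1 + r) / 2 - β ≥ L (1 - r) / 2 > 0`
  obtain ⟨g, hg⟩ : ∃ g : ℝ, g = L * (1 + r) / 2 - β := ⟨_, rfl⟩
  have hgpos : 0 < g := by
    rw [hg]
    nlinarith [mul_pos hLpos (sub_pos.2 hr1)]
  refine ⟨g / 2, half_pos hgpos, ?_⟩
  -- for `0 < b ≤ b₁`: `exp (-1/(bk)) ≤ δ`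
  have hexpδ : Real.exp (-(1 / (b * k))) ≤ δ := by
    have h1 : b * (k * -Real.log δ) ≤ 1 := by
      calc b * (k * -Real.log δ) ≤ 1 / (k * -Real.log δ) * (k * -Real.log δ) := by gcongr
        _ = 1 := by field_simp
    have h2 : -Real.log δ ≤ 1 / (b * k) := by
      rw [le_div_iff₀ (by positivity)]
      calc -Real.log δ * (b * k) = b * (k * -Real.log δ) := by ring
        _ ≤ 1 := h1
    calc Real.exp (-(1 / (b * k))) ≤ Real.exp (Real.log δ) := Real.exp_le_exp.2 (by linarith)
      _ = δ := Real.exp_log hδpos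
  -- the main estimate, eventually in `n`
  filter_upwards [cha_poly_le_exp (((k : ℝ) + 1) * 2 ^ (k + 1) * Real.exp 1)
    (A * (k + 1) + 2 ^ k) (half_pos hgpos)] with n hn K hK E hE₁ hE₂
  have hn0 : (0 : ℝ) ≤ n := Nat.cast_nonneg n
  have hE₀ : 1 - δ ≤ E := by linarith
  have hEnn : 0 ≤ E := by linarith
  -- Bernoulli: `E ^ k ≥ 1 + k (E - 1) ≥ 1 - k δ = (1 + r) / 2`
  have hEk : (1 + r) / 2 ≤ E ^ k := by
    have h1 := one_add_mul_sub_le_pow (show (-1 : ℝ) ≤ E by linarith) k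
    have h2 : (k : ℝ) * -δ ≤ k * (E - 1) := mul_le_mul_of_nonneg_left (by linarith) hk0.le
    linarith
  have hq0 : 0 ≤ (E / 2) ^ k := by positivity
  have hq1 : (E / 2) ^ k ≤ 1 := pow_le_one₀ (by positivity) (by linarith)
  -- `(1 - (E/2)^k)^m ≤ e · exp (-(L (1+r)/2) n)`
  have hA : (1 - (E / 2) ^ k) ^ ⌊5 * 2 ^ k * Real.log k / k * n⌋₊ ≤
      Real.exp 1 * Real.exp (-(L * (1 + r) / 2 * n)) := by
    set m := ⌊5 * 2 ^ k * Real.log k / k * n⌋₊ with hm_def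
    have hm : 5 * 2 ^ k * Real.log k / k * n - 1 < (m : ℝ) := Nat.sub_one_lt_floor _
    have hαq : (E / 2) ^ k * (5 * 2 ^ k * Real.log k / k) = E ^ k * L := by
      rw [hL, div_pow]
      field_simp
    have h1 : (E / 2) ^ k * (5 * 2 ^ k * Real.log k / k * n - 1) ≤ (E / 2) ^ k * m :=
      mul_le_mul_of_nonneg_left hm.le hq0
    have h2 : (E / 2) ^ k * (5 * 2 ^ k * Real.log k / k * n - 1) =
        E ^ k * L * n - (E / 2) ^ k := by
      rw [← hαq]
      ring
    have h12 : E ^ k * L * n - (E / 2) ^ k ≤ (E / 2) ^ k * m := h2.symm.trans_le h1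
    have h3 : (1 + r) / 2 * L * n ≤ E ^ k * L * n := by gcongr
    have hkey : -((E / 2) ^ k * m) ≤ 1 - L * (1 + r) / 2 * n := by linarith
    calc (1 - (E / 2) ^ k) ^ m ≤ (Real.exp (-((E / 2) ^ k))) ^ m := by
          apply pow_le_pow_left₀ (sub_nonneg.2 hq1)
          linarith [Real.add_one_le_exp (-((E / 2) ^ k))]
      _ = Real.exp ((m : ℝ) * -((E / 2) ^ k)) := (Real.exp_nat_mul _ _).symm
      _ ≤ Real.exp (1 + -(L * (1 + r) / 2 * n)) := Real.exp_le_exp.2 (by linarith)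
      _ = Real.exp 1 * Real.exp (-(L * (1 + r) / 2 * n)) := Real.exp_add _ _
  -- `K + 1 ≤ 2 (n + 1) ^ A`
  have hKb : (K : ℝ) + 1 ≤ 2 * ((n : ℝ) + 1) ^ A := by
    have h1 : (K : ℝ) ≤ (n : ℝ) ^ A := by exact_mod_cast hK
    have h2 : (n : ℝ) ^ A ≤ ((n : ℝ) + 1) ^ A := pow_le_pow_left₀ hn0 (by linarith) A
    have h3 : (1 : ℝ) ≤ ((n : ℝ) + 1) ^ A := one_le_pow₀ (by linarith)
    linarith
  -- assemble
  calc ((k : ℝ) + 1) * ((K : ℝ) + 1) ^ (k + 1) * ((((n : ℝ) + 1) ^ (2 ^ k)) * Real.exp (n * β)) *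
        (1 - (E / 2) ^ k) ^ ⌊5 * 2 ^ k * Real.log k / k * n⌋₊
      ≤ ((k : ℝ) + 1) * ((K : ℝ) + 1) ^ (k + 1) * ((((n : ℝ) + 1) ^ (2 ^ k)) * Real.exp (n * β)) *
        (Real.exp 1 * Real.exp (-(L * (1 + r) / 2 * n))) :=
        mul_le_mul_of_nonneg_left hA (by positivity)
    _ ≤ ((k : ℝ) + 1) * (2 * ((n : ℝ) + 1) ^ A) ^ (k + 1) *
        ((((n : ℝ) + 1) ^ (2 ^ k)) * Real.exp (n * β)) *
        (Real.exp 1 * Real.exp (-(L * (1 + r) / 2 * n))) := by gcongr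
    _ = ((k : ℝ) + 1) * 2 ^ (k + 1) * Real.exp 1 * ((n : ℝ) + 1) ^ (A * (k + 1) + 2 ^ k) *
        (Real.exp (n * β) * Real.exp (-(L * (1 + r) / 2 * n))) := by ring
    _ ≤ Real.exp (g / 2 * n) * (Real.exp (n * β) * Real.exp (-(L * (1 + r) / 2 * n))) := by
        gcongr
    _ = Real.exp (-(g / 2 * n)) := by
        rw [← Real.exp_add, ← Real.exp_add, hg]
        congr 1
        ring

end Summit.PneNP.PneNP.Theorems
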